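import Summits.QuantumFields.YangMills.Theorems.BlockPlaquetteOneStepLinearisation
import HarnessLib

/-!
# `BlockPlaquetteOneStepLinearisationReadings` — the offset-mean collapsed and bounded, and the `dist₁` readings of the one-step linearisation of
# [Balaban1987RG1] (0.4) + `exp[mean log]` coarse plaquettes (file 3 of 3 of brick (M1))

Cell `ym3-torus` (YM ladder rung R3 = continuum SU(2) Yang–Mills on T³ — a RUNG, NOT the Clay problem: not d = 4, not infinite volume, not a
mass gap), crux of record `UnitScaleTilt.HistoryTailL` (stmt-QuantumFields-19936), width seat `ym-ust-19936-w2` (gen 14).  Brick **(M1)** of the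
crux idea «gross-sd-transfer» (LINE 28 candidate, `Cruxes/HistoryTailL/Ideas/gross-sd-transfer.md`, annex 1 §2 (iv) ∕ §3 «S_lin»; this seat's LOCATE
`LOCATE-LINE28-SLIN-w2g14.md` = 19936 evidence #51; ideator word «w2: GO (M1)» 2026-08-29T16:31:51Z): the FIRST of the four missing pieces of the
linearisation `dist₁(Ū^j(∂a)) = |linear flux functional| + O(·)` on the crux's own types — the AVERAGING step (the Stokes step (b′) is px10 g7's,
the j-fold induction (M3) and the `log` chart (M4) are later bricks).

WHAT IS PRINTED.  T. Bałaban, *Averaging operations for lattice gauge theories*, Commun. Math. Phys. **98** (1985) 17–51 [Balaban1985Averaging],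
p. 25–26, inside the proof of Proposition 1 (51): *«|V̄₀(∂p′) − 1 − i Σ_{c⊂∂p′} Σ_{x∈B(c₋)} L^{−d} A(Γ_{c,x})| < O(1)(L²α₀)² (47)  Denoting by
(p′)_x a plaquette obtained by translation of the plaquette p′ to the point x, we have the identity Σ_{c⊂∂p′} Σ_{x∈B(c₋)} L^{−d} A(Γ_{c,x}) =
Σ_{x∈B(y₀)} L^{−d} A(∂(p′)_x) (48)»* — the coarse plaquette of the averaged field is, to FIRST order, the block mean of the TRANSLATED COARSE
SQUARES `∂(p′)_x`.  T. Bałaban, *Renormalization group approach to lattice gauge field theories. I*, Commun. Math. Phys. **109** (1987) 249–301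
[Balaban1987RG1], (0.3)–(0.4) pp. 252–253 (the symmetric block averaging with all staircase orderings) and p. 253 *«The considerations and
results of this, and previous papers, do not depend on any particular averaging operation used»*.

WHAT THIS FILE PROVES (kernel; 0 `def`, 0 `sorry`; file 3 of 3, one namespace with files 1–2).  From file 2's
★★★`norm_plaqHol_avgFun_sub_one_sub_offsetMean_le`:
* ★ `offsetMean_eq_mean_pair` — the transported translated square at `J = (r, σ, τ, ρ, ω)` depends on `(r, σ)` only, so the offset-mean over `J` is
  the mean over `(r, σ) ∈ (Fin d → Fin L) × Perm (Fin d)` (bookkeeping for the consumers (b′)∕(M3), which tile `U(∂(p′)_x)` per block point);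
* ★ `norm_offsetMean_transportedSquare_sub_one_le` — the offset-mean has norm `≤ L²a` (conjugation invariance + exact lattice Stokes per square:
  the printed main term of (50)–(51));
* ★ `dist1_plaqHol_avgFun_le'` — CONSISTENCY CHECK: Prop. 1 (51) `dist₁(Ū(∂p′)) ≤ L²a + 143·s²` recovered from the linearisation and the size of
  its main term (the statement of the tree's ✓`dist1_plaqHol_avgFun_le`);
* ★ `abs_dist1_plaqHol_avgFun_sub_norm_offsetMean_le` — THE `dist₁` READING `|dist₁(Ū(∂p′)) − ‖offset-mean‖| ≤ 143·s²` (the shape S_lin's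
  `j`-fold induction (M3) iterates: the coarse plaquette deviation of the averaged field IS the norm of the first-order term up to second order).

HONEST FRAMING.  Deterministic lattice bookkeeping on the tree's own objects; a helper toward an UNREGISTERED idea's stub (S_lin of LINE 28) and
line-independent infrastructure (also the first-order half of LINE 15's `stub_levelOneLipschitz` Schur bound); `--supports stmt-QuantumFields-19936`.
It proves no stub, crux, rung or summit statement; nothing of Bałaban's beyond the displayed algebra is asserted; S_lin ∕ S_dom ∕
«ShallowFluxSecondMomentL» ∕ (Q) ∕ K1 ∕ `MeanDeviationL` ∕ `HistoryTailL` are NOT proved; the Yang–Mills mass gap is NOT proved.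

References: [Balaban1985Averaging] T. Bałaban, CMP 98 (1985) 17–51, (47)–(48) and Prop. 1 (51) pp. 25–26; [Balaban1987RG1] T. Bałaban, CMP 109
(1987) 249–301, (0.3)–(0.4) pp. 252–253.
-/

noncomputable section

open scoped BigOperators

namespace Summit.QuantumFields.YangMills.Theorems.BlockPlaquetteOneStepLinearisation

open Literature.MathematicalPhysics.QuantumFieldTheory.Balaban1983to89
open Literature.MathematicalPhysics.QuantumFieldTheory.Balaban1983to89.BlockAveragingEMLProp2

section MeanLetters

variable {𝔸 : Type*} [NormedRing 𝔸] [NormedAlgebra ℂ 𝔸] {ι : Type*} [Fintype ι]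

/-- The mean of a family bounded by `B` in norm has norm `≤ B`. [folklore] -/
private theorem norm_mean_le [Nonempty ι] {m : ι → 𝔸} {B : ℝ} (h : ∀ i, ‖m i‖ ≤ B) :
    ‖((Fintype.card ι : ℂ))⁻¹ • ∑ i, m i‖ ≤ B := by
  have hc : (0 : ℝ) < Fintype.card ι := Nat.cast_pos.mpr Fintype.card_pos
  have hsum : ∑ i, ‖m i‖ ≤ ∑ _i : ι, B := Finset.sum_le_sum fun i _ => h i
  rw [Finset.sum_const, Finset.card_univ, nsmul_eq_mul] at hsum
  rw [norm_smul, norm_inv, Complex.norm_natCast, inv_mul_le_iff₀ hc]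
  exact (norm_sum_le _ _).trans hsum

end MeanLetters

/-! ## The offset-mean over the coupled index, and the `dist₁` readings -/

section Readings

open T4Continuum BlockAveraging AveragingRT ExpMeanLog LatticeWordStokes B10Eq47AxialChi NormedSpace
open scoped Matrix.Norms.L2Operator

variable {n : Type*} [Fintype n] [DecidableEq n] [Nonempty n] {P : Params} {j : ℕ}

/-- **THE OFFSET-MEAN COLLAPSES TO THE MEAN OVER `(r, σ)`**: the transported translated square at the coupled index `J = (r, σ, τ, ρ, ω)` depends
on `(r, σ)` only, so its mean over `J` is its mean over `(r, σ) ∈ (Fin d → Fin L) × Perm (Fin d)` (bookkeeping for the consumers (b′)∕(M3),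
which tile `U(∂(p′)_x)` per block point `x = x(r, σ)`). [cite: Balaban1987RG1, (0.3)-(0.4) pp.252-253 (bookkeeping)] -/
theorem offsetMean_eq_mean_pair {𝕄 : Type*} [AddCommGroup 𝕄] [Module ℂ 𝕄]
    (g : (Fin P.d → Fin P.L) × Equiv.Perm (Fin P.d) → 𝕄) :
    ((Fintype.card ((Fin P.d → Fin P.L) × Equiv.Perm (Fin P.d) × Equiv.Perm (Fin P.d) × Equiv.Perm (Fin P.d) ×
        Equiv.Perm (Fin P.d)) : ℂ))⁻¹ • ∑ J : (Fin P.d → Fin P.L) × Equiv.Perm (Fin P.d) × Equiv.Perm (Fin P.d) ×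
        Equiv.Perm (Fin P.d) × Equiv.Perm (Fin P.d), g (J.1, J.2.1) =
      ((Fintype.card ((Fin P.d → Fin P.L) × Equiv.Perm (Fin P.d)) : ℂ))⁻¹ • ∑ i : (Fin P.d → Fin P.L) × Equiv.Perm (Fin P.d), g i := by
  haveI : Nonempty (Fin P.d → Fin P.L) := ⟨fun _ => ⟨0, P.L_pos⟩⟩
  have hR : (Fintype.card (Fin P.d → Fin P.L) : ℂ) ≠ 0 := Nat.cast_ne_zero.mpr Fintype.card_ne_zero
  have hS : (Fintype.card (Equiv.Perm (Fin P.d)) : ℂ) ≠ 0 := Nat.cast_ne_zero.mpr Fintype.card_ne_zero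
  have hsum : ∑ J : (Fin P.d → Fin P.L) × Equiv.Perm (Fin P.d) × Equiv.Perm (Fin P.d) × Equiv.Perm (Fin P.d) × Equiv.Perm (Fin P.d),
      g (J.1, J.2.1) = Fintype.card (Equiv.Perm (Fin P.d) × Equiv.Perm (Fin P.d) × Equiv.Perm (Fin P.d)) •
        ∑ i : (Fin P.d → Fin P.L) × Equiv.Perm (Fin P.d), g i := by
    simp only [Fintype.sum_prod_type, Finset.sum_const, Finset.card_univ, Finset.smul_sum]
  rw [hsum, ← Nat.cast_smul_eq_nsmul ℂ, smul_smul]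
  congr 1
  simp only [Fintype.card_prod, Nat.cast_mul]
  field_simp

/-- **THE OFFSET-MEAN IS WITHIN `L²a` OF ZERO** (conjugation invariance + exact lattice Stokes for each translated square): the first-order term
itself has norm `≤ L²a`, the printed main term of (50)–(51). [cite: Balaban1985Averaging, (19) p.21 and (50)-(51) p.26] -/
theorem norm_offsetMean_transportedSquare_sub_one_le {a : ℝ} {U : GaugeField P j (Matrix.specialUnitaryGroup n ℂ)}
    (hU : ∀ q : Plaq P j, dist1 (GaugeField.plaqHol U q) ≤ a) (y : Site P (j + 1)) {μ ν : Fin P.d} (hμν : μ < ν) :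
    ‖((Fintype.card ((Fin P.d → Fin P.L) × Equiv.Perm (Fin P.d) × Equiv.Perm (Fin P.d) × Equiv.Perm (Fin P.d) ×
          Equiv.Perm (Fin P.d)) : ℂ))⁻¹ • ∑ J : (Fin P.d → Fin P.L) × Equiv.Perm (Fin P.d) × Equiv.Perm (Fin P.d) ×
          Equiv.Perm (Fin P.d) × Equiv.Perm (Fin P.d),
          ((((holAt U (walk (emb y) (stairWord J.2.1 (off J.1))) * rect U (walkEnd (emb y) (stairWord J.2.1 (off J.1))) μ ν P.L P.L *
            (holAt U (walk (emb y) (stairWord J.2.1 (off J.1))))⁻¹ : Matrix.specialUnitaryGroup n ℂ)) : Matrix n n ℂ) - 1)‖ ≤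
      (P.L : ℝ) ^ 2 * a := by
  haveI : Nonempty (Fin P.d → Fin P.L) := ⟨fun _ => ⟨0, P.L_pos⟩⟩
  refine norm_mean_le fun J => ?_
  rw [← FederbushMean.dist1_SU_eq]
  exact dist1_conj_rect_le U hU _ _ hμν

/-- **CONSISTENCY CHECK — PROPOSITION 1 (51) RECOVERED**: `dist₁(Ū(∂p′)) ≤ L²a + 143·s²`, the statement of the tree's ✓`dist1_plaqHol_avgFun_le`,
from the linearisation and the size of its main term. [cite: Balaban1985Averaging, Prop. 1 (51) p.26] -/
theorem dist1_plaqHol_avgFun_le' {a : ℝ} (ha : 0 ≤ a) {U : GaugeField P j (Matrix.specialUnitaryGroup n ℂ)}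
    (hU : ∀ q : Plaq P j, dist1 (GaugeField.plaqHol U q) ≤ a)
    (hs : ((((P.d + 4) * P.L : ℕ) : ℝ) ^ 2 / 4) * a ≤ deltaSU n / 2) (y : Site P (j + 1)) {μ ν : Fin P.d} (hμν : μ < ν) :
    dist1 (GaugeField.plaqHol (avgFun (expMeanLogSU (n := n)) U) ⟨y, μ, ν, hμν⟩) ≤
      (P.L : ℝ) ^ 2 * a + 143 * (((((P.d + 4) * P.L : ℕ) : ℝ) ^ 2 / 4) * a) ^ 2 := by
  have h1 := norm_plaqHol_avgFun_sub_one_sub_offsetMean_le ha hU hs y hμν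
  have h2 := norm_offsetMean_transportedSquare_sub_one_le hU y hμν
  rw [FederbushMean.dist1_SU_eq]
  have := norm_sub_le_norm_sub_add_norm_sub
    ((((GaugeField.plaqHol (avgFun (expMeanLogSU (n := n)) U) ⟨y, μ, ν, hμν⟩ : Matrix.specialUnitaryGroup n ℂ) : Matrix n n ℂ) - 1))
    (((Fintype.card ((Fin P.d → Fin P.L) × Equiv.Perm (Fin P.d) × Equiv.Perm (Fin P.d) × Equiv.Perm (Fin P.d) ×
          Equiv.Perm (Fin P.d)) : ℂ))⁻¹ • ∑ J : (Fin P.d → Fin P.L) × Equiv.Perm (Fin P.d) × Equiv.Perm (Fin P.d) ×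
          Equiv.Perm (Fin P.d) × Equiv.Perm (Fin P.d),
          ((((holAt U (walk (emb y) (stairWord J.2.1 (off J.1))) * rect U (walkEnd (emb y) (stairWord J.2.1 (off J.1))) μ ν P.L P.L *
            (holAt U (walk (emb y) (stairWord J.2.1 (off J.1))))⁻¹ : Matrix.specialUnitaryGroup n ℂ)) : Matrix n n ℂ) - 1))
    (0 : Matrix n n ℂ)
  rw [sub_zero, sub_zero] at this
  linarith

/-- **THE `dist₁` READING**: `|dist₁(Ū(∂p′)) − ‖offset-mean of the transported translated-square deviations‖| ≤ 143·s²` — the coarse plaquette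
deviation of the averaged field IS the norm of the first-order term up to second order (the shape S_lin's `j`-fold induction (M3) iterates).
[cite: Balaban1985Averaging, (47)-(48) pp.25-26] -/
theorem abs_dist1_plaqHol_avgFun_sub_norm_offsetMean_le {a : ℝ} (ha : 0 ≤ a) {U : GaugeField P j (Matrix.specialUnitaryGroup n ℂ)}
    (hU : ∀ q : Plaq P j, dist1 (GaugeField.plaqHol U q) ≤ a)
    (hs : ((((P.d + 4) * P.L : ℕ) : ℝ) ^ 2 / 4) * a ≤ deltaSU n / 2) (y : Site P (j + 1)) {μ ν : Fin P.d} (hμν : μ < ν) :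
    |dist1 (GaugeField.plaqHol (avgFun (expMeanLogSU (n := n)) U) ⟨y, μ, ν, hμν⟩) -
        ‖((Fintype.card ((Fin P.d → Fin P.L) × Equiv.Perm (Fin P.d) × Equiv.Perm (Fin P.d) × Equiv.Perm (Fin P.d) ×
          Equiv.Perm (Fin P.d)) : ℂ))⁻¹ • ∑ J : (Fin P.d → Fin P.L) × Equiv.Perm (Fin P.d) × Equiv.Perm (Fin P.d) ×
          Equiv.Perm (Fin P.d) × Equiv.Perm (Fin P.d),
          ((((holAt U (walk (emb y) (stairWord J.2.1 (off J.1))) * rect U (walkEnd (emb y) (stairWord J.2.1 (off J.1))) μ ν P.L P.L *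
            (holAt U (walk (emb y) (stairWord J.2.1 (off J.1))))⁻¹ : Matrix.specialUnitaryGroup n ℂ)) : Matrix n n ℂ) - 1)‖| ≤
      143 * (((((P.d + 4) * P.L : ℕ) : ℝ) ^ 2 / 4) * a) ^ 2 := by
  rw [FederbushMean.dist1_SU_eq]
  exact (abs_norm_sub_norm_le _ _).trans (norm_plaqHol_avgFun_sub_one_sub_offsetMean_le ha hU hs y hμν)

end Readings

end Summit.QuantumFields.YangMills.Theorems.BlockPlaquetteOneStepLinearisation

end
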